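import Summits.QuantumFields.BalabanUV.T4Continuum.Support.UnitaryCayleyPath

/-!
# UnitaryResolventMargin — BRICK B2c of the requested lattice lemma `torusSmallFieldGlobalGauge` (INTERFACE REQUEST NE7, route #1 of the
# NE7 crux, stub S7 NODE O): the RESOLVENT MARGIN of a unitary at the point `−scay k` — Neumann perturbation (`1∕‖(W + c)⁻¹‖` drops by at
# most `‖W′ − W‖`), the level family `Good k s` (monotone, conjugation-invariant, `ε`-robust), and the INITIAL MARGIN by pigeonhole: every
# `W ∈ U(n)` has `k ∈ {0, …, |n|}` with `‖(W + scay k)⁻¹‖ ≤ (|n| + 1)²` (unitary diagonalisation through `MatrixLog.exists_isHermitian_exp_eq`)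

Cell `pub-balaban`, rung (B)+1 sub-cell t4, lineage `b2b-balaban-t4-ne7-p1`, generation 26 (CRUX PROVER NE7 #1, ruling e34b3e0c); crux
skeleton `t4/skeletons/NE7-CRUX-R1.md` v1.7.6 §4 «INTERFACE REQUEST NE7» (HOME/INBOX.md ll.6031–6037); bricks B1 = `TorusGaugeComb` (p259900),
B2a = `UnitaryCayley` (p260933), B2b = `UnitaryCayleyPath`, B3a = `TorusLineHolonomy` (p261222), B3b = `TorusHolonomySpreading`.  HONEST FRAMING
(page 1): FIXED FINITE T⁴, rung (B)+1; NE7, NE3 NOT PRINTED in [Balaban1984PropagatorsI]–[Balaban1989LargeFieldII] and NOT PROVED here; continuum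
YM on T⁴ ⇐ BetaPertH ∧ nine spine estimates (0/9 proved); BetaPertH ⇐ (D1) ∧ (D4) ∧ CAP+tail; G-an2-4 gates asym, D1 and NE2/3/4; NOT infinite
volume, NOT mass gap, NOT Clay.

WHY.  The Cayley path of brick B2b is Lipschitz in the holonomy `W` with constant `4‖(W + c)⁻¹‖²` and has speed `O((|k| + ‖(W + c)⁻¹‖)∕M)`; the
spreading step (brick B3b) therefore needs ONE resolvent point `−c = −scay k` that stays quantitatively away from the spectra of ALL Polyakov
holonomies of one direction.  This file supplies the two ingredients: the margin `s ↦ s − ε` is stable under `ε`-perturbation and under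
conjugation (so it propagates across the torus by `TorusHolonomySpreading.holo_good_all`), and at ONE base point a margin `(|n| + 1)⁻²` is
available for some `k ≤ |n|` (the `|n|` eigenvalues cannot be `(|n|+1)⁻²`-close to all `|n| + 1` points `−scay k`, which are pairwise
`2(|n|+1)⁻²`-separated).
WHAT ([folklore]): §1 **`neumann`**; §2 **`Good`**, `good_unitary`, `good_isUnit`, `good_norm_le`, **`good_mono`**, **`good_conj`**, **`good_pert`**;
§3 `exists_conjDiag_of_unitary` (unitary diagonalisation), `resolv_conjDiag`, `two_mul_abs_sub_le_scay`, **`exists_initial_margin`**.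
HONEST: elementary; nothing of Bałaban asserted; nothing of NE3∕NE7 discharged; 0 sorry.
-/

set_option autoImplicit false

open scoped BigOperators Matrix Matrix.Norms.L2Operator ComplexConjugate
open NormedSpace Complex Matrix

namespace Summit.QuantumFields.BalabanUV.T4Continuum.UnitaryResolventMargin

open Literature.MathematicalPhysics.QuantumFieldTheory.Balaban1983to89
open B7Prop2Explicit (unitaryUnits mem_unitaryUnits)
open UnitaryCayley UnitaryCayleyPath

noncomputable section

variable {n : Type*} [Fintype n] [DecidableEq n]

/-! ## §1 Neumann perturbation of an invertible matrix -/

/-- **NEUMANN PERTURBATION**: if `‖R⁻¹‖ ≤ K`, `‖T‖ ≤ ε` and `Kε < 1` then `R + T` is invertible with `‖(R + T)⁻¹‖ ≤ K∕(1 − Kε)`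
(`R + T = R(1 − S)`, `S = −R⁻¹T`, geometric series `Units.oneSub`). [folklore] -/
theorem neumann [Nonempty n] {R T : Matrix n n ℂ} (hR : IsUnit R.det) {K ε : ℝ} (hK : ‖R⁻¹‖ ≤ K) (hT : ‖T‖ ≤ ε) (hKε : K * ε < 1) :
    IsUnit (R + T).det ∧ ‖(R + T)⁻¹‖ ≤ K / (1 - K * ε) := by
  have hK0 : 0 ≤ K := (norm_nonneg _).trans hK
  have hε0 : 0 ≤ ε := (norm_nonneg _).trans hT
  set S : Matrix n n ℂ := -(R⁻¹ * T) with hS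
  have hSn : ‖S‖ ≤ K * ε := by
    rw [hS, norm_neg]
    exact (norm_mul_le _ _).trans (mul_le_mul hK hT (norm_nonneg _) hK0)
  have hS1 : ‖S‖ < 1 := lt_of_le_of_lt hSn hKε
  set u := Units.oneSub S hS1 with hu
  have hval : (u : Matrix n n ℂ) = 1 - S := Units.val_oneSub S hS1
  have hRT : R + T = R * (u : Matrix n n ℂ) := by
    rw [hval, hS, sub_neg_eq_add, mul_add, mul_one, ← mul_assoc, Matrix.mul_nonsing_inv _ hR, one_mul]
  have hudet : IsUnit (u : Matrix n n ℂ).det := (Matrix.isUnit_iff_isUnit_det _).mp (Units.isUnit u)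
  refine ⟨by rw [hRT, Matrix.det_mul]; exact hR.mul hudet, ?_⟩
  -- `(R u)⁻¹ = u⁻¹ R⁻¹`, `‖u⁻¹‖ = ‖Σ Sⁿ‖ ≤ (1 − ‖S‖)⁻¹`
  have huinv : ((u : Matrix n n ℂ))⁻¹ = ((u⁻¹ : (Matrix n n ℂ)ˣ) : Matrix n n ℂ) := (Matrix.coe_units_inv u).symm
  have hgeom : ‖((u⁻¹ : (Matrix n n ℂ)ˣ) : Matrix n n ℂ)‖ ≤ (1 - K * ε)⁻¹ := by
    have h := tsum_geometric_le_of_norm_lt_one S hS1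
    rw [norm_one, sub_self, zero_add] at h
    have h2 : (1 - ‖S‖)⁻¹ ≤ (1 - K * ε)⁻¹ := by
      apply inv_anti₀ (by linarith) (by linarith)
    exact h.trans h2
  rw [hRT, Matrix.mul_inv_rev, huinv]
  calc _ ≤ ‖((u⁻¹ : (Matrix n n ℂ)ˣ) : Matrix n n ℂ)‖ * ‖R⁻¹‖ := norm_mul_le _ _
    _ ≤ (1 - K * ε)⁻¹ * K := mul_le_mul hgeom hK (norm_nonneg _) (inv_nonneg.mpr (by linarith))
    _ = K / (1 - K * ε) := by rw [div_eq_inv_mul]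

/-! ## §2 The level family `Good k s` -/

/-- **THE GOOD SET AT LEVEL `s`**: unitary units `W` such that, if `s > 0`, the resolvent `W + scay k·1` is invertible with `s·‖(W + scay k)⁻¹‖ ≤ 1`
(for `s ≤ 0` only unitarity is asked, so that the family is monotone in `s` all the way down). [folklore] -/
def Good (k s : ℝ) : Set (Matrix n n ℂ)ˣ :=
  {W | W ∈ unitaryUnits (Matrix n n ℂ) ∧ (0 < s → IsUnit (resolv k W).det ∧ s * ‖(resolv k W)⁻¹‖ ≤ 1)}

variable {k s : ℝ}

/-- Members of `Good` are unitary. [folklore] -/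
theorem good_unitary {W : (Matrix n n ℂ)ˣ} (hW : W ∈ Good k s) : W ∈ unitaryUnits (Matrix n n ℂ) := hW.1

/-- At a positive level the resolvent is invertible. [folklore] -/
theorem good_isUnit (hs : 0 < s) {W : (Matrix n n ℂ)ˣ} (hW : W ∈ Good k s) : IsUnit (resolv k W).det := (hW.2 hs).1

/-- At a positive level `‖(resolv k W)⁻¹‖ ≤ s⁻¹`. [folklore] -/
theorem good_norm_le (hs : 0 < s) {W : (Matrix n n ℂ)ˣ} (hW : W ∈ Good k s) : ‖(resolv k W)⁻¹‖ ≤ s⁻¹ := by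
  have h := (hW.2 hs).2
  rw [mul_comm, ← le_div_iff₀ hs, one_div] at h
  exact h

/-- **MONOTONICITY**: `s′ ≤ s ⟹ Good k s ⊆ Good k s′`. [folklore] -/
theorem good_mono {s' : ℝ} (hss : s' ≤ s) : Good k s ⊆ Good (n := n) k s' := by
  intro W hW
  refine ⟨hW.1, fun hs' => ?_⟩
  have hs : 0 < s := lt_of_lt_of_le hs' hss
  refine ⟨(hW.2 hs).1, le_trans ?_ (hW.2 hs).2⟩
  exact mul_le_mul_of_nonneg_right hss (norm_nonneg _)

/-- **CONJUGATION INVARIANCE**: `W ∈ Good k s`, `B` unitary ⟹ `B W B⁻¹ ∈ Good k s`. [folklore] -/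
theorem good_conj {W B : (Matrix n n ℂ)ˣ} (hW : W ∈ Good k s) (hB : B ∈ unitaryUnits (Matrix n n ℂ)) : B * W * B⁻¹ ∈ Good k s := by
  refine ⟨(unitaryUnits _).mul_mem ((unitaryUnits _).mul_mem hB hW.1) ((unitaryUnits _).inv_mem hB), fun hs => ?_⟩
  have h := resolv_conj_inv k hB (hW.2 hs).1
  exact ⟨h.1, by rw [h.2]; exact (hW.2 hs).2⟩

/-- **PERTURBATION**: `W ∈ Good k s`, `W′` unitary, `‖W′ − W‖ ≤ ε ⟹ W′ ∈ Good k (s − ε)` (Neumann). [folklore] -/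
theorem good_pert [Nonempty n] {ε : ℝ} {W W' : (Matrix n n ℂ)ˣ} (hW : W ∈ Good k s) (hW' : W' ∈ unitaryUnits (Matrix n n ℂ))
    (hε : ‖((W' : (Matrix n n ℂ)ˣ) : Matrix n n ℂ) - W‖ ≤ ε) : W' ∈ Good k (s - ε) := by
  refine ⟨hW', fun hsε => ?_⟩
  have hε0 : 0 ≤ ε := (norm_nonneg _).trans hε
  have hs : 0 < s := by linarith
  have hR := (hW.2 hs).1
  have hK : ‖(resolv k W)⁻¹‖ ≤ s⁻¹ := good_norm_le hs hW
  have hKε : s⁻¹ * ε < 1 := by rw [inv_mul_lt_iff₀ hs]; linarith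
  have hdec : resolv k W' = resolv k W + (((W' : (Matrix n n ℂ)ˣ) : Matrix n n ℂ) - W) := by
    simp only [resolv]; abel
  have h := neumann hR hK hε hKε
  rw [← hdec] at h
  refine ⟨h.1, ?_⟩
  have e : s⁻¹ / (1 - s⁻¹ * ε) = (s - ε)⁻¹ := by
    field_simp
  rw [e] at h
  calc (s - ε) * ‖(resolv k W')⁻¹‖ ≤ (s - ε) * (s - ε)⁻¹ := by gcongr; exact h.2
    _ = 1 := mul_inv_cancel₀ hsε.ne'

/-! ## §3 The initial margin by pigeonhole -/

/-- **UNITARY DIAGONALISATION** (from `MatrixLog.exists_isHermitian_exp_eq` and `Matrix.IsHermitian.spectral_theorem`): every `W ∈ U(n)` is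
`V·diag(λ)·V⋆` with unitary `V` and `|λ_j| = 1`. [folklore] -/
theorem exists_conjDiag_of_unitary {W : Matrix n n ℂ} (hW : W ∈ Matrix.unitaryGroup n ℂ) :
    ∃ (V : Matrix.unitaryGroup n ℂ) (lam : n → ℂ), (∀ j, ‖lam j‖ = 1) ∧ W = conjDiag V lam := by
  obtain ⟨A, hA, -, hexp, -, -⟩ := MatrixLog.exists_isHermitian_exp_eq hW
  set V := hA.eigenvectorUnitary with hV
  have hsp : A = conjDiag V (fun j => ((hA.eigenvalues j : ℝ) : ℂ)) := by
    have h := hA.spectral_theorem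
    rw [Unitary.conjStarAlgAut_apply] at h
    exact h
  have hVm : (V : Matrix n n ℂ) ∈ Matrix.unitaryGroup n ℂ := V.2
  have hVinv := inv_eq_star_of_mem hVm
  refine ⟨V, fun j => Complex.exp (I * ((hA.eigenvalues j : ℝ) : ℂ)), fun j => ?_, ?_⟩
  · dsimp only
    rw [mul_comm, Complex.norm_exp_ofReal_mul_I]
  · rw [← hexp]
    conv_lhs => rw [hsp, conjDiag, ← Matrix.smul_mul, ← Matrix.mul_smul, ← diagonal_smul, ← hVinv.2]
    rw [Matrix.exp_conj _ _ ((Matrix.isUnit_iff_isUnit_det _).mpr hVinv.1), Matrix.exp_diagonal, hVinv.2, conjDiag]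
    have ev : NormedSpace.exp (I • fun j => ((hA.eigenvalues j : ℝ) : ℂ)) = fun j => Complex.exp (I * ((hA.eigenvalues j : ℝ) : ℂ)) := by
      rw [Pi.exp_def]
      funext j
      rw [Pi.smul_apply, smul_eq_mul, congrFun Complex.exp_eq_exp_ℂ]
    rw [ev]

/-- The resolvent of a diagonalised unit: `conjDiag V λ + c·1 = conjDiag V (λ + c)`. [folklore] -/
theorem resolv_conjDiag (k : ℝ) {W : (Matrix n n ℂ)ˣ} {V : Matrix.unitaryGroup n ℂ} {lam : n → ℂ} (h : (W : Matrix n n ℂ) = conjDiag V lam) :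
    resolv k W = conjDiag V (fun j => lam j + scay k) := by
  rw [resolv, h, ← conjDiag_one V]
  have e : (fun j => lam j + scay k) = (1 : ℂ) • lam + scay k • (fun _ : n => (1 : ℂ)) := by
    funext j; simp
  rw [e, ← conjDiag_lin, one_smul]

/-- Separation of the candidate resolvent points: `2|a − b| ≤ (1 + |a|)(1 + |b|)·|scay a − scay b|`
(`scay a − scay b = 2i(a − b)∕((1 − ia)(1 − ib))`, `|1 − ia| ≤ 1 + |a|`). [folklore] -/
theorem two_mul_abs_sub_le_scay (a b : ℝ) : 2 * |a - b| ≤ (1 + |a|) * (1 + |b|) * ‖scay a - scay b‖ := by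
  have ha := (one_sub_I_mul_real a).1
  have hb := (one_sub_I_mul_real b).1
  have hid : scay a - scay b = 2 * I * ((a : ℂ) - b) / ((1 - I * a) * (1 - I * b)) := by
    unfold scay
    field_simp
    ring
  have hn : ‖scay a - scay b‖ * (‖(1 : ℂ) - I * a‖ * ‖(1 : ℂ) - I * b‖) = 2 * |a - b| := by
    rw [hid, norm_div, norm_mul, norm_mul, norm_mul, Complex.norm_I, ← Complex.ofReal_sub, Complex.norm_real, Real.norm_eq_abs,
      div_mul_cancel₀ _ (mul_ne_zero (norm_ne_zero_iff.mpr ha) (norm_ne_zero_iff.mpr hb))]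
    norm_num
  have h1a : ‖(1 : ℂ) - I * a‖ ≤ 1 + |a| := by
    refine (norm_sub_le _ _).trans ?_
    rw [norm_one, norm_mul, Complex.norm_I, one_mul, Complex.norm_real, Real.norm_eq_abs]
  have h1b : ‖(1 : ℂ) - I * b‖ ≤ 1 + |b| := by
    refine (norm_sub_le _ _).trans ?_
    rw [norm_one, norm_mul, Complex.norm_I, one_mul, Complex.norm_real, Real.norm_eq_abs]
  rw [← hn]
  have h0 : 0 ≤ ‖scay a - scay b‖ := norm_nonneg _
  calc ‖scay a - scay b‖ * (‖(1 : ℂ) - I * a‖ * ‖(1 : ℂ) - I * b‖) ≤ ‖scay a - scay b‖ * ((1 + |a|) * (1 + |b|)) := by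
        gcongr
    _ = (1 + |a|) * (1 + |b|) * ‖scay a - scay b‖ := by ring

/-- The margin constant `s_n = (|n| + 1)⁻²`. [folklore] -/
def marginConst (n : Type*) [Fintype n] : ℝ := (((Fintype.card n : ℝ) + 1) ^ 2)⁻¹

omit [DecidableEq n] in
/-- `0 < s_n ≤ 1`. [folklore] -/
theorem marginConst_pos : 0 < marginConst n ∧ marginConst n ≤ 1 := by
  unfold marginConst
  refine ⟨by positivity, inv_le_one_of_one_le₀ ?_⟩
  have : (1 : ℝ) ≤ (Fintype.card n : ℝ) + 1 := by linarith [Nat.cast_nonneg (α := ℝ) (Fintype.card n)]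
  nlinarith

/-- **THE INITIAL MARGIN**: every unitary `W` has a `k ∈ {0, …, |n|}` with `W ∈ Good k s_n`, `s_n = (|n| + 1)⁻²`, i.e. `W + scay k` invertible
with `s_n·‖(W + scay k)⁻¹‖ ≤ 1` (pigeonhole on the `|n|` eigenvalues against the `|n| + 1` pairwise `2s_n`-separated points `−scay k`). [folklore] -/
theorem exists_initial_margin {W : (Matrix n n ℂ)ˣ} (hW : W ∈ unitaryUnits (Matrix n n ℂ)) :
    ∃ k : ℕ, k ≤ Fintype.card n ∧ W ∈ Good (k : ℝ) (marginConst n) := by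
  obtain ⟨V, lam, hlam, hdiag⟩ := exists_conjDiag_of_unitary (mem_unitaryUnits.mp hW)
  set K := Fintype.card n with hK
  set s := marginConst n with hs
  have hs0 : 0 < s := marginConst_pos.1
  -- a candidate `k` all of whose shifted eigenvalues are `s`-far gives the margin
  have hgood : ∀ k : ℕ, (∀ j, s ≤ ‖lam j + scay k‖) → W ∈ Good (k : ℝ) s := by
    intro k hk
    refine ⟨hW, fun _ => ?_⟩
    have hne : ∀ j, lam j + scay k ≠ 0 := fun j h => by
      have := hk j; rw [h, norm_zero] at this; linarith
    have hR := resolv_conjDiag (k : ℝ) hdiag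
    have hinv := conjDiag_inv V hne
    rw [hR, hinv.2]
    refine ⟨hinv.1, ?_⟩
    have hb : ‖conjDiag V (fun j => (lam j + scay k)⁻¹)‖ ≤ s⁻¹ :=
      norm_conjDiag_le V (inv_nonneg.mpr hs0.le) fun j => by
        rw [norm_inv]; exact inv_anti₀ hs0 (hk j)
    calc s * ‖conjDiag V (fun j => (lam j + scay k)⁻¹)‖ ≤ s * s⁻¹ := by gcongr
      _ = 1 := mul_inv_cancel₀ hs0.ne'
  by_contra hcon
  push Not at hcon
  -- every candidate `k ≤ K` has a close eigenvalue
  have hbad : ∀ k : Fin (K + 1), ∃ j, ‖lam j + scay (k : ℕ)‖ < s := by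
    intro k
    by_contra hk
    push Not at hk
    exact hcon k (by have := k.2; omega) (hgood k hk)
  choose f hf using hbad
  have hcard : Fintype.card n < Fintype.card (Fin (K + 1)) := by rw [Fintype.card_fin]; omega
  obtain ⟨k₁, k₂, hne, heq⟩ := Fintype.exists_ne_map_eq_of_card_lt f hcard
  -- the two candidate points are `< 2s` apart through the common eigenvalue ...
  have hclose : ‖scay (k₁ : ℕ) - scay (k₂ : ℕ)‖ < 2 * s := by
    have e : scay ((k₁ : ℕ) : ℝ) - scay ((k₂ : ℕ) : ℝ) = (lam (f k₁) + scay (k₁ : ℕ)) - (lam (f k₂) + scay (k₂ : ℕ)) := by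
      rw [heq]; ring
    rw [e]
    calc _ ≤ ‖lam (f k₁) + scay (k₁ : ℕ)‖ + ‖lam (f k₂) + scay (k₂ : ℕ)‖ := norm_sub_le _ _
      _ < s + s := add_lt_add (hf k₁) (hf k₂)
      _ = 2 * s := by ring
  -- ... but distinct naturals `≤ K` give points `≥ 2(K+1)⁻² = 2s` apart
  have hsep := two_mul_abs_sub_le_scay ((k₁ : ℕ) : ℝ) ((k₂ : ℕ) : ℝ)
  have hk1 : |((k₁ : ℕ) : ℝ)| ≤ K := by rw [abs_of_nonneg (by positivity)]; exact_mod_cast (by have := k₁.2; omega)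
  have hk2 : |((k₂ : ℕ) : ℝ)| ≤ K := by rw [abs_of_nonneg (by positivity)]; exact_mod_cast (by have := k₂.2; omega)
  have hdiff : (1 : ℝ) ≤ |((k₁ : ℕ) : ℝ) - ((k₂ : ℕ) : ℝ)| := by
    have hne' : (k₁ : ℕ) ≠ (k₂ : ℕ) := fun h => hne (Fin.ext h)
    have hz : ((k₁ : ℕ) : ℤ) - ((k₂ : ℕ) : ℤ) ≠ 0 := by omega
    have h2 : ((1 : ℤ) : ℝ) ≤ ((|((k₁ : ℕ) : ℤ) - ((k₂ : ℕ) : ℤ)| : ℤ) : ℝ) := Int.cast_le.mpr (Int.one_le_abs hz)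
    rw [Int.cast_one, Int.cast_abs, Int.cast_sub, Int.cast_natCast, Int.cast_natCast] at h2
    exact h2
  have hKs : ((K : ℝ) + 1) ^ 2 * s = 1 := by
    rw [hs, marginConst, ← hK]; exact mul_inv_cancel₀ (by positivity)
  have hprod : (1 + |((k₁ : ℕ) : ℝ)|) * (1 + |((k₂ : ℕ) : ℝ)|) ≤ ((K : ℝ) + 1) ^ 2 := by
    nlinarith [abs_nonneg (((k₁ : ℕ) : ℝ)), abs_nonneg (((k₂ : ℕ) : ℝ))]
  have h0 : 0 ≤ ‖scay ((k₁ : ℕ) : ℝ) - scay ((k₂ : ℕ) : ℝ)‖ := norm_nonneg _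
  have h1 : (2 : ℝ) ≤ (1 + |((k₁ : ℕ) : ℝ)|) * (1 + |((k₂ : ℕ) : ℝ)|) * ‖scay ((k₁ : ℕ) : ℝ) - scay ((k₂ : ℕ) : ℝ)‖ :=
    le_trans (by linarith) hsep
  have h2 : (1 + |((k₁ : ℕ) : ℝ)|) * (1 + |((k₂ : ℕ) : ℝ)|) * ‖scay ((k₁ : ℕ) : ℝ) - scay ((k₂ : ℕ) : ℝ)‖
      ≤ ((K : ℝ) + 1) ^ 2 * ‖scay ((k₁ : ℕ) : ℝ) - scay ((k₂ : ℕ) : ℝ)‖ := mul_le_mul_of_nonneg_right hprod h0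
  have h3 : ((K : ℝ) + 1) ^ 2 * ‖scay ((k₁ : ℕ) : ℝ) - scay ((k₂ : ℕ) : ℝ)‖ < ((K : ℝ) + 1) ^ 2 * (2 * s) :=
    mul_lt_mul_of_pos_left hclose (by positivity)
  have h4 : ((K : ℝ) + 1) ^ 2 * (2 * s) = 2 := by linear_combination 2 * hKs
  linarith

end

end Summit.QuantumFields.BalabanUV.T4Continuum.UnitaryResolventMargin
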